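import Mathlib
import HarnessLib
import Summits.RiemannHypothesis.RiemannHypothesis.Theorems.DbrWallAntipersistenceLogSeventeen
import Summits.RiemannHypothesis.RiemannHypothesis.Theorems.DbrWallLogNineteenBounds

/-!
# DBR column, rung B-P(P1): anti-persistence of the zeta screw line — rung `(log 19)/2`
# (`Ψ(2s) < 2Ψ(s)` for every `0 < s ≤ (log 19)/2`)

RH-FREE calculus inequality (LINE 1 of the label discipline): a theorem about the closed form (1.1) of Suzuki's
screw function `Ψ = Literature.NumberTheory.LFunctions.zetaScrew` with its prime terms `Λ(n)n^{−1/2}(t − log n)₊`,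
`n ≤ 19`; NOT worded as, and not, progress toward RH («`Ψ(2s) < 2Ψ(s)` for all `s > 0`» stays a conjecture from data).

Twelfth rung of the ladder (ladder lemma `zetaScrew_two_mul_lt_two_mul_of_piece`): piece `[(log 17)/2, (log 19)/2]`, `φ(2s)`
carries `2, 3, 4, 5, 7, 8, 9, 11, 13, 16, 17` (`Λ(18) = 0`), `φ(s)` carries `2, 3, 4`; lower end = rung `(log 17)/2`; upper end =
ONE certificate at `s₁ = (log 19)/2` (`ρ = 19^{1/4}`, `2.087797 < ρ < 2.087798`; twenty terms `≥ 0.27918` + tail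
`≥ (1−19^{−21})²/85`, `4(ρ−1)² < 4.733218`; prime terms `> 4.4689`; numerically `F((log 19)/2) = 0.0273`, margin `0.027`).
Result: `zetaScrew_two_mul_lt_two_mul_of_le_half_log_nineteen`. Nothing here bears on the truth of RH.
References: M. Suzuki, J. Lond. Math. Soc. (2) 108 (2023) = arXiv:2206.03682, (1.1) [Suzuki2023]. -/

set_option linter.dupNamespace false

noncomputable section

open scoped BigOperators
open Set
namespace Summit.RiemannHypothesis.RiemannHypothesis.Theorems.DbrWall

open Literature.NumberTheory.LFunctions

/-! ### The prime sum on `log 17 ≤ t ≤ log 19` and the shape of the gap on the piece -/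

/-- For `log 17 ≤ t ≤ log 19`: `φ(t) = Σ_{n ∈ {2,3,4,5,7,8,9,11,13,16,17}} Λ(n)n^{−1/2}(t − log n)` (`Λ(18) = 0`).
[cite: Suzuki2023, (1.1)] -/
theorem zetaScrewPrimeSum_eq_of_log_seventeen_le {t : ℝ} (h17 : Real.log 17 ≤ t) (h19 : t ≤ Real.log 19) :
    zetaScrewPrimeSum t = Real.log 2 / Real.sqrt 2 * (t - Real.log 2)
      + Real.log 3 / Real.sqrt 3 * (t - Real.log 3) + Real.log 2 / 2 * (t - Real.log 4)
      + Real.log 5 / Real.sqrt 5 * (t - Real.log 5) + Real.log 7 / Real.sqrt 7 * (t - Real.log 7)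
      + Real.log 2 / Real.sqrt 8 * (t - Real.log 8) + Real.log 3 / 3 * (t - Real.log 9)
      + Real.log 11 / Real.sqrt 11 * (t - Real.log 11) + Real.log 13 / Real.sqrt 13 * (t - Real.log 13)
      + Real.log 2 / 4 * (t - Real.log 16) + Real.log 17 / Real.sqrt 17 * (t - Real.log 17) := by
  have h23 : Real.log 2 < Real.log 3 := Real.log_lt_log (by norm_num) (by norm_num)
  have h34 : Real.log 3 < Real.log 4 := Real.log_lt_log (by norm_num) (by norm_num)
  have h45 : Real.log 4 < Real.log 5 := Real.log_lt_log (by norm_num) (by norm_num)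
  have h57 : Real.log 5 < Real.log 7 := Real.log_lt_log (by norm_num) (by norm_num)
  have h78 : Real.log 7 < Real.log 8 := Real.log_lt_log (by norm_num) (by norm_num)
  have h89 : Real.log 8 < Real.log 9 := Real.log_lt_log (by norm_num) (by norm_num)
  have h911 : Real.log 9 < Real.log 11 := Real.log_lt_log (by norm_num) (by norm_num)
  have h1113 : Real.log 11 < Real.log 13 := Real.log_lt_log (by norm_num) (by norm_num)
  have h1316 : Real.log 13 < Real.log 16 := Real.log_lt_log (by norm_num) (by norm_num)
  have h1617 : Real.log 16 < Real.log 17 := Real.log_lt_log (by norm_num) (by norm_num)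
  have ht0 : 0 < t := lt_of_lt_of_le (Real.log_pos (by norm_num : (1:ℝ) < 17)) h17
  have hM : Real.exp |t| ≤ ((19 : ℕ) : ℝ) := by
    rw [abs_of_pos ht0]
    calc Real.exp t ≤ Real.exp (Real.log 19) := Real.exp_le_exp.2 h19
      _ = 19 := Real.exp_log (by norm_num)
      _ = ((19 : ℕ) : ℝ) := by norm_num
  rw [zetaScrewPrimeSum_eq_sum_max hM, abs_of_pos ht0,
    show Finset.Icc (1 : ℕ) 19 = {1, 2, 3, 4, 5, 6, 7, 8, 9, 10, 11, 12, 13, 14, 15, 16, 17, 18, 19} from by decide,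
    Finset.sum_insert (by decide), Finset.sum_insert (by decide),
    Finset.sum_insert (by decide), Finset.sum_insert (by decide), Finset.sum_insert (by decide),
    Finset.sum_insert (by decide), Finset.sum_insert (by decide), Finset.sum_insert (by decide),
    Finset.sum_insert (by decide), Finset.sum_insert (by decide), Finset.sum_insert (by decide),
    Finset.sum_insert (by decide), Finset.sum_insert (by decide), Finset.sum_insert (by decide),
    Finset.sum_insert (by decide), Finset.sum_insert (by decide), Finset.sum_insert (by decide),
    Finset.sum_insert (by decide), Finset.sum_singleton]
  have h1 : ArithmeticFunction.vonMangoldt 1 = 0 := ArithmeticFunction.vonMangoldt_apply_one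
  have hΛ2 : ArithmeticFunction.vonMangoldt 2 = Real.log 2 := by
    rw [ArithmeticFunction.vonMangoldt_apply_prime Nat.prime_two]; norm_num
  have hΛ3 : ArithmeticFunction.vonMangoldt 3 = Real.log 3 := by
    rw [ArithmeticFunction.vonMangoldt_apply_prime Nat.prime_three]; norm_num
  have hΛ4 : ArithmeticFunction.vonMangoldt 4 = Real.log 2 := by
    rw [show (4 : ℕ) = 2 ^ 2 by norm_num, ArithmeticFunction.vonMangoldt_apply_pow two_ne_zero,
      ArithmeticFunction.vonMangoldt_apply_prime Nat.prime_two]; norm_num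
  have hΛ5 : ArithmeticFunction.vonMangoldt 5 = Real.log 5 := by
    rw [ArithmeticFunction.vonMangoldt_apply_prime Nat.prime_five]; norm_num
  have hΛ6 : ArithmeticFunction.vonMangoldt 6 = 0 :=
    ArithmeticFunction.vonMangoldt_eq_zero_iff.2 (by decide)
  have hΛ7 : ArithmeticFunction.vonMangoldt 7 = Real.log 7 := by
    rw [ArithmeticFunction.vonMangoldt_apply_prime Nat.prime_seven]; norm_num
  have hΛ8 : ArithmeticFunction.vonMangoldt 8 = Real.log 2 := by
    rw [show (8 : ℕ) = 2 ^ 3 by norm_num, ArithmeticFunction.vonMangoldt_apply_pow (by norm_num),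
      ArithmeticFunction.vonMangoldt_apply_prime Nat.prime_two]; norm_num
  have hΛ9 : ArithmeticFunction.vonMangoldt 9 = Real.log 3 := by
    rw [show (9 : ℕ) = 3 ^ 2 by norm_num, ArithmeticFunction.vonMangoldt_apply_pow two_ne_zero,
      ArithmeticFunction.vonMangoldt_apply_prime Nat.prime_three]; norm_num
  have hΛ10 : ArithmeticFunction.vonMangoldt 10 = 0 :=
    ArithmeticFunction.vonMangoldt_eq_zero_iff.2 (by decide)
  have hΛ11 : ArithmeticFunction.vonMangoldt 11 = Real.log 11 := by
    rw [ArithmeticFunction.vonMangoldt_apply_prime (by norm_num)]; norm_num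
  have hΛ12 : ArithmeticFunction.vonMangoldt 12 = 0 :=
    ArithmeticFunction.vonMangoldt_eq_zero_iff.2 (by decide)
  have hΛ13 : ArithmeticFunction.vonMangoldt 13 = Real.log 13 := by
    rw [ArithmeticFunction.vonMangoldt_apply_prime (by norm_num)]; norm_num
  have hΛ14 : ArithmeticFunction.vonMangoldt 14 = 0 :=
    ArithmeticFunction.vonMangoldt_eq_zero_iff.2 (by decide)
  have hΛ15 : ArithmeticFunction.vonMangoldt 15 = 0 := by
    -- `15 = 3 · 5` is not a prime power (the `decide` instance stalls on odd `minFac`)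
    rw [ArithmeticFunction.vonMangoldt_eq_zero_iff, isPrimePow_nat_iff]
    rintro ⟨p, k, hp, hk, h⟩
    have hdvd : p ∣ 15 := by rw [← h]; exact dvd_pow_self p hk.ne'
    have h35 : p ∣ 3 * 5 := by norm_num; exact hdvd
    rcases (Nat.Prime.dvd_mul hp).1 h35 with h3 | h5
    · have hp3 : p = 3 := (Nat.prime_dvd_prime_iff_eq hp Nat.prime_three).1 h3
      subst hp3
      have h5k : 5 ∣ 3 ^ k := by rw [h]; norm_num
      have := Nat.Prime.dvd_of_dvd_pow Nat.prime_five h5k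
      norm_num at this
    · have hp5 : p = 5 := (Nat.prime_dvd_prime_iff_eq hp Nat.prime_five).1 h5
      subst hp5
      have h3k : 3 ∣ 5 ^ k := by rw [h]; norm_num
      have := Nat.Prime.dvd_of_dvd_pow Nat.prime_three h3k
      norm_num at this
  have hΛ16 : ArithmeticFunction.vonMangoldt 16 = Real.log 2 := by
    rw [show (16 : ℕ) = 2 ^ 4 by norm_num, ArithmeticFunction.vonMangoldt_apply_pow (by norm_num),
      ArithmeticFunction.vonMangoldt_apply_prime Nat.prime_two]; norm_num
  have hΛ17 : ArithmeticFunction.vonMangoldt 17 = Real.log 17 := by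
    rw [ArithmeticFunction.vonMangoldt_apply_prime (by norm_num)]; norm_num
  have hΛ18 : ArithmeticFunction.vonMangoldt 18 = 0 :=
    ArithmeticFunction.vonMangoldt_eq_zero_iff.2 (by decide)
  have hs4 : Real.sqrt ((4 : ℕ) : ℝ) = 2 := by
    rw [show ((4 : ℕ) : ℝ) = 2 ^ 2 by norm_num, Real.sqrt_sq (by norm_num)]
  have hs9 : Real.sqrt ((9 : ℕ) : ℝ) = 3 := by
    rw [show ((9 : ℕ) : ℝ) = 3 ^ 2 by norm_num, Real.sqrt_sq (by norm_num)]
  have hs16 : Real.sqrt ((16 : ℕ) : ℝ) = 4 := by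
    rw [show ((16 : ℕ) : ℝ) = 4 ^ 2 by norm_num, Real.sqrt_sq (by norm_num)]
  have hm2 : max (t - Real.log ((2 : ℕ) : ℝ)) 0 = t - Real.log 2 := by
    push_cast; exact max_eq_left (by linarith)
  have hm3 : max (t - Real.log ((3 : ℕ) : ℝ)) 0 = t - Real.log 3 := by
    push_cast; exact max_eq_left (by linarith)
  have hm4 : max (t - Real.log ((4 : ℕ) : ℝ)) 0 = t - Real.log 4 := by
    push_cast; exact max_eq_left (by linarith)
  have hm5 : max (t - Real.log ((5 : ℕ) : ℝ)) 0 = t - Real.log 5 := by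
    push_cast; exact max_eq_left (by linarith)
  have hm7 : max (t - Real.log ((7 : ℕ) : ℝ)) 0 = t - Real.log 7 := by
    push_cast; exact max_eq_left (by linarith)
  have hm8 : max (t - Real.log ((8 : ℕ) : ℝ)) 0 = t - Real.log 8 := by
    push_cast; exact max_eq_left (by linarith)
  have hm9 : max (t - Real.log ((9 : ℕ) : ℝ)) 0 = t - Real.log 9 := by
    push_cast; exact max_eq_left (by linarith)
  have hm11 : max (t - Real.log ((11 : ℕ) : ℝ)) 0 = t - Real.log 11 := by
    push_cast; exact max_eq_left (by linarith)
  have hm13 : max (t - Real.log ((13 : ℕ) : ℝ)) 0 = t - Real.log 13 := by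
    push_cast; exact max_eq_left (by linarith)
  have hm16 : max (t - Real.log ((16 : ℕ) : ℝ)) 0 = t - Real.log 16 := by
    push_cast; exact max_eq_left (by linarith)
  have hm17 : max (t - Real.log ((17 : ℕ) : ℝ)) 0 = t - Real.log 17 := by
    push_cast; exact max_eq_left (by linarith)
  have hm19 : max (t - Real.log ((19 : ℕ) : ℝ)) 0 = 0 := by
    push_cast; exact max_eq_right (by linarith)
  rw [h1, hΛ2, hΛ3, hΛ4, hΛ5, hΛ6, hΛ7, hΛ8, hΛ9, hΛ10, hΛ11, hΛ12, hΛ13, hΛ14, hΛ15, hΛ16, hΛ17, hΛ18, hs4,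
    hs9, hs16, hm2, hm3, hm4, hm5, hm7, hm8, hm9, hm11, hm13, hm16, hm17, hm19]
  push_cast
  ring

/-- **Shape of the gap on `[(log 17)/2, (log 19)/2]`**: `2Ψ(t) − Ψ(2t) = D(t) + (log 2/√2)(2t − log 2) + (αt + β)`, the affine
remainder collecting the ramps of `3, 4, 5, 7, 8, 9, 11, 13, 16, 17` in `φ(2t)` and of `2, 3, 4` in `φ(t)`. [folklore] -/
theorem two_mul_zetaScrew_sub_shape_log_seventeen_nineteen (t : ℝ) (h17 : Real.log 17 / 2 ≤ t)
    (h19 : t ≤ Real.log 19 / 2) :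
    2 * zetaScrew t - zetaScrew (2 * t) =
      (∑' k : ℕ, (1 - Real.exp (-((2 * (k : ℝ) + 5 / 2) * t))) ^ 2 / (2 * (k : ℝ) + 5 / 2) ^ 2)
      - 4 * (Real.exp (t / 2) - 1) ^ 2 + Real.log 2 / Real.sqrt 2 * (2 * t - Real.log 2)
      + ((2 * (Real.log 3 / Real.sqrt 3) + Real.log 2 + 2 * (Real.log 5 / Real.sqrt 5)
          + 2 * (Real.log 7 / Real.sqrt 7) + 2 * (Real.log 2 / Real.sqrt 8) + 2 * (Real.log 3 / 3)
          + 2 * (Real.log 11 / Real.sqrt 11) + 2 * (Real.log 13 / Real.sqrt 13) + 2 * (Real.log 2 / 4)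
          + 2 * (Real.log 17 / Real.sqrt 17)
          - 2 * (Real.log 2 / Real.sqrt 2) - 2 * (Real.log 3 / Real.sqrt 3) - 2 * (Real.log 2 / 2)) * t
        + (-(Real.log 3 / Real.sqrt 3 * Real.log 3) - Real.log 2 / 2 * Real.log 4
          - Real.log 5 / Real.sqrt 5 * Real.log 5 - Real.log 7 / Real.sqrt 7 * Real.log 7
          - Real.log 2 / Real.sqrt 8 * Real.log 8 - Real.log 3 / 3 * Real.log 9 - Real.log 11 / Real.sqrt 11 * Real.log 11
          - Real.log 13 / Real.sqrt 13 * Real.log 13 - Real.log 2 / 4 * Real.log 16 - Real.log 17 / Real.sqrt 17 * Real.log 17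
          + 2 * (Real.log 2 / Real.sqrt 2) * Real.log 2 + 2 * (Real.log 3 / Real.sqrt 3) * Real.log 3
          + 2 * (Real.log 2 / 2) * Real.log 4)) := by
  have hl2 : 0 < Real.log 2 := Real.log_pos one_lt_two
  have h1616 : Real.log 16 = 2 * Real.log 4 := by
    rw [show (16 : ℝ) = 4 ^ 2 by norm_num, Real.log_pow]; norm_num
  have h1617 : Real.log 16 < Real.log 17 := Real.log_lt_log (by norm_num) (by norm_num)
  have h1925 : Real.log 19 < 2 * Real.log 5 := by
    have h' : Real.log 19 < Real.log 25 := Real.log_lt_log (by norm_num) (by norm_num)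
    have h25 : Real.log 25 = 2 * Real.log 5 := by
      rw [show (25 : ℝ) = 5 ^ 2 by norm_num, Real.log_pow]; norm_num
    linarith
  have hs0 : 0 ≤ t := by
    have := Real.log_nonneg (show (1 : ℝ) ≤ 17 by norm_num); linarith
  have hs4 : Real.log 4 ≤ t := by linarith
  have hs5 : t ≤ Real.log 5 := by linarith
  rw [two_mul_zetaScrew_sub_eq_gap_add_primeSums hs0,
    zetaScrewPrimeSum_eq_of_log_seventeen_le (by linarith) (by linarith),
    zetaScrewPrimeSum_eq_of_log_four_le hs4 hs5]
  ring

/-! ### The certificate at `s₁ = (log 19)/2` (constants from `DbrWallLogNineteenBounds`) -/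

/-- **`F((log 19)/2) > 0`** in the affine form of the ladder lemma (numerically `F = −4.4420 + 4.4692 = 0.0273`). [folklore] -/
theorem gap_affine_half_log_nineteen_pos :
    0 < (∑' k : ℕ, (1 - Real.exp (-((2 * (k : ℝ) + 5 / 2) * (Real.log 19 / 2)))) ^ 2
            / (2 * (k : ℝ) + 5 / 2) ^ 2)
        - 4 * (Real.exp (Real.log 19 / 2 / 2) - 1) ^ 2
        + Real.log 2 / Real.sqrt 2 * (2 * (Real.log 19 / 2) - Real.log 2)
        + ((2 * (Real.log 3 / Real.sqrt 3) + Real.log 2 + 2 * (Real.log 5 / Real.sqrt 5)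
          + 2 * (Real.log 7 / Real.sqrt 7) + 2 * (Real.log 2 / Real.sqrt 8) + 2 * (Real.log 3 / 3)
          + 2 * (Real.log 11 / Real.sqrt 11) + 2 * (Real.log 13 / Real.sqrt 13) + 2 * (Real.log 2 / 4)
          + 2 * (Real.log 17 / Real.sqrt 17)
          - 2 * (Real.log 2 / Real.sqrt 2) - 2 * (Real.log 3 / Real.sqrt 3) - 2 * (Real.log 2 / 2)) * (Real.log 19 / 2)
        + (-(Real.log 3 / Real.sqrt 3 * Real.log 3) - Real.log 2 / 2 * Real.log 4
          - Real.log 5 / Real.sqrt 5 * Real.log 5 - Real.log 7 / Real.sqrt 7 * Real.log 7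
          - Real.log 2 / Real.sqrt 8 * Real.log 8 - Real.log 3 / 3 * Real.log 9 - Real.log 11 / Real.sqrt 11 * Real.log 11
          - Real.log 13 / Real.sqrt 13 * Real.log 13 - Real.log 2 / 4 * Real.log 16 - Real.log 17 / Real.sqrt 17 * Real.log 17
          + 2 * (Real.log 2 / Real.sqrt 2) * Real.log 2 + 2 * (Real.log 3 / Real.sqrt 3) * Real.log 3
          + 2 * (Real.log 2 / 2) * Real.log 4)) := by
  set r := Real.exp (Real.log 19 / 4) with hr
  have hr0 : 0 < r := Real.exp_pos _
  obtain ⟨hr4, hr_lo, hr_hi⟩ := exp_log_nineteen_div_four_bounds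
  have hrinv : r⁻¹ ≤ 0.47898 := by
    rw [inv_eq_one_div, div_le_iff₀ hr0]; nlinarith
  have hrinv1 : r⁻¹ ≤ 1 := by
    rw [inv_eq_one_div, div_le_iff₀ hr0]; nlinarith
  have hrinv0 : 0 ≤ r⁻¹ := by positivity
  have hs0 : (0 : ℝ) ≤ Real.log 19 / 2 := by
    have := Real.log_nonneg (show (1 : ℝ) ≤ 19 by norm_num); positivity
  rw [show Real.log 19 / 2 / 2 = Real.log 19 / 4 by ring]
  simp only [exp_neg_lam_mul_half_log_nineteen]
  have hS : Summable fun k : ℕ =>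
      (1 - (1 / 19 : ℝ) ^ (k + 1) * r⁻¹) ^ 2 / (2 * (k : ℝ) + 5 / 2) ^ 2 := by
    have := summable_gap_terms hs0
    simp only [exp_neg_lam_mul_half_log_nineteen] at this
    exact this
  rw [← hS.sum_add_tsum_nat_add 20]
  have hterm : ∀ k : ℕ, (1 - (1 / 19 : ℝ) ^ (k + 1) * 0.47898) ^ 2 / (2 * (k : ℝ) + 5 / 2) ^ 2
      ≤ (1 - (1 / 19 : ℝ) ^ (k + 1) * r⁻¹) ^ 2 / (2 * (k : ℝ) + 5 / 2) ^ 2 := by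
    intro k
    apply div_le_div_of_nonneg_right _ (by positivity)
    have hq0 : 0 ≤ (1 / 19 : ℝ) ^ (k + 1) := by positivity
    have hq1 : (1 / 19 : ℝ) ^ (k + 1) ≤ 1 := pow_le_one₀ (by norm_num) (by norm_num)
    have hlo : 0 ≤ 1 - (1 / 19 : ℝ) ^ (k + 1) * 0.47898 := by nlinarith
    have hle : 1 - (1 / 19 : ℝ) ^ (k + 1) * 0.47898 ≤ 1 - (1 / 19 : ℝ) ^ (k + 1) * r⁻¹ := by
      nlinarith [mul_le_mul_of_nonneg_left hrinv hq0]
    exact pow_le_pow_left₀ hlo hle 2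
  have hnum : (0.27918 : ℝ) ≤
      ∑ k ∈ Finset.range 20, (1 - (1 / 19 : ℝ) ^ (k + 1) * 0.47898) ^ 2 / (2 * (k : ℝ) + 5 / 2) ^ 2 := by
    simp only [Finset.sum_range_succ, Finset.sum_range_zero]
    norm_num
  have hhead : (0.27918 : ℝ) ≤
      ∑ k ∈ Finset.range 20, (1 - (1 / 19 : ℝ) ^ (k + 1) * r⁻¹) ^ 2 / (2 * (k : ℝ) + 5 / 2) ^ 2 :=
    hnum.trans (Finset.sum_le_sum fun k _ => hterm k)
  have hT := Literature.Probability.LatticeModels.hasSum_telescope (show (0 : ℝ) < 85 / 4 by norm_num)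
  have hTs : Summable fun k : ℕ =>
      (1 - (1 / 19 : ℝ) ^ 21) ^ 2 / 4 * (1 / (((k : ℝ) + 85 / 4) * ((k : ℝ) + 85 / 4 + 1))) :=
    (hT.mul_left _).summable
  have hTval : ∑' k : ℕ, (1 - (1 / 19 : ℝ) ^ 21) ^ 2 / 4 * (1 / (((k : ℝ) + 85 / 4) * ((k : ℝ) + 85 / 4 + 1)))
      = (1 - (1 / 19 : ℝ) ^ 21) ^ 2 / 4 * (1 / (85 / 4)) := (hT.mul_left _).tsum_eq
  have htail : ∑' k : ℕ, (1 - (1 / 19 : ℝ) ^ 21) ^ 2 / 4 * (1 / (((k : ℝ) + 85 / 4) * ((k : ℝ) + 85 / 4 + 1)))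
      ≤ ∑' k : ℕ, (1 - (1 / 19 : ℝ) ^ (k + 20 + 1) * r⁻¹) ^ 2 / (2 * ((k + 20 : ℕ) : ℝ) + 5 / 2) ^ 2 := by
    refine hTs.tsum_le_tsum (fun k => ?_) ((summable_nat_add_iff 20).2 hS)
    have hq0 : 0 ≤ (1 / 19 : ℝ) ^ (k + 20 + 1) * r⁻¹ := by positivity
    have hq1 : (1 / 19 : ℝ) ^ (k + 20 + 1) * r⁻¹ ≤ (1 / 19 : ℝ) ^ 21 := by
      have h1 : (1 / 19 : ℝ) ^ (k + 20 + 1) ≤ (1 / 19 : ℝ) ^ 21 :=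
        pow_le_pow_of_le_one (by norm_num) (by norm_num) (by omega)
      have h2 : (1 / 19 : ℝ) ^ (k + 20 + 1) * r⁻¹ ≤ (1 / 19 : ℝ) ^ (k + 20 + 1) * 1 :=
        mul_le_mul_of_nonneg_left hrinv1 (by positivity)
      linarith
    have hnum0 : 0 ≤ 1 - (1 / 19 : ℝ) ^ 21 := by norm_num
    have hnum1 : (1 - (1 / 19 : ℝ) ^ 21) ^ 2 ≤ (1 - (1 / 19 : ℝ) ^ (k + 20 + 1) * r⁻¹) ^ 2 :=
      pow_le_pow_left₀ hnum0 (by linarith) 2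
    have hk : (0 : ℝ) ≤ k := Nat.cast_nonneg k
    have hden : (2 * ((k + 20 : ℕ) : ℝ) + 5 / 2) ^ 2 ≤ 4 * (((k : ℝ) + 85 / 4) * ((k : ℝ) + 85 / 4 + 1)) := by
      push_cast; nlinarith
    have hden0 : 0 < (2 * ((k + 20 : ℕ) : ℝ) + 5 / 2) ^ 2 := by positivity
    rw [show (1 - (1 / 19 : ℝ) ^ 21) ^ 2 / 4 * (1 / (((k : ℝ) + 85 / 4) * ((k : ℝ) + 85 / 4 + 1)))
        = (1 - (1 / 19 : ℝ) ^ 21) ^ 2 / (4 * (((k : ℝ) + 85 / 4) * ((k : ℝ) + 85 / 4 + 1))) by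
      field_simp]
    exact div_le_div₀ (by positivity) hnum1 hden0 hden
  rw [hTval] at htail
  have htailnum : (0.01176 : ℝ) ≤ (1 - (1 / 19 : ℝ) ^ 21) ^ 2 / 4 * (1 / (85 / 4)) := by norm_num
  have hsub : 4 * (r - 1) ^ 2 < 4.733218 := by nlinarith
  have hprime := prime_terms_half_log_nineteen_gt
  linarith

/-! ### Assembly (ladder lemma) -/

/-- **Anti-persistence of the zeta screw line for every mesh up to `(log 19)/2`** (RH-FREE calculus inequality):
`Ψ(2s) < 2Ψ(s)` for every `0 < s ≤ (log 19)/2`. [folklore] -/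
theorem zetaScrew_two_mul_lt_two_mul_of_le_half_log_nineteen {s : ℝ} (hs0 : 0 < s)
    (hs : s ≤ Real.log 19 / 2) : zetaScrew (2 * s) < 2 * zetaScrew s := by
  rcases le_total s (Real.log 17 / 2) with h | h
  · exact zetaScrew_two_mul_lt_two_mul_of_le_half_log_seventeen hs0 h
  · have h17 : 0 < Real.log 17 / 2 := by
      have := Real.log_pos (show (1 : ℝ) < 17 by norm_num); positivity
    have h217 : Real.log 2 / 2 ≤ Real.log 17 / 2 := by
      have := Real.log_lt_log (by norm_num) (show (2 : ℝ) < 17 by norm_num); linarith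
    have h1719 : Real.log 17 / 2 ≤ Real.log 19 / 2 := by
      have := Real.log_lt_log (by norm_num) (show (17 : ℝ) < 19 by norm_num); linarith
    have h0 : 0 < 2 * zetaScrew (Real.log 17 / 2) - zetaScrew (2 * (Real.log 17 / 2)) := by
      have := zetaScrew_two_mul_lt_two_mul_of_le_half_log_seventeen h17 le_rfl
      linarith
    have h1 : 0 < 2 * zetaScrew (Real.log 19 / 2) - zetaScrew (2 * (Real.log 19 / 2)) := by
      rw [two_mul_zetaScrew_sub_shape_log_seventeen_nineteen (Real.log 19 / 2) h1719 le_rfl]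
      exact gap_affine_half_log_nineteen_pos
    exact zetaScrew_two_mul_lt_two_mul_of_piece h217 two_mul_zetaScrew_sub_shape_log_seventeen_nineteen h0 h1
      h hs

/-- Negative lag-one increment covariance `c₁(s) = Ψ(2s) − 2Ψ(s) + Ψ(0) < 0` for every mesh `0 < s ≤ (log 19)/2`.
[folklore] -/
theorem lagOne_increment_cov_neg_of_le_half_log_nineteen {s : ℝ} (hs0 : 0 < s) (hs : s ≤ Real.log 19 / 2) :
    zetaScrew (2 * s) - 2 * zetaScrew s + zetaScrew 0 < 0 := by
  have h := zetaScrew_two_mul_lt_two_mul_of_le_half_log_nineteen hs0 hs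
  rw [zetaScrew_zero]
  linarith

end Summit.RiemannHypothesis.RiemannHypothesis.Theorems.DbrWall
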